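import Summits.AtomisticToContinuum.HydrodynamicLimit.Theorems.MourreKoopmanChargesStressStrongMixingStaticClustering
import Summits.AtomisticToContinuum.HydrodynamicLimit.Theorems.MourreKoopmanChargesStressStrongMixingTwoTimeClustering
import HarnessLib

/-!
# `StressStrongMixing` · line `birth`: stub `stub_twoTimeClusteringOfLocality`
# (flow locality ⇒ two-time spatial clustering of the six generators)

Closes the registered stub `stub_twoTimeClusteringOfLocality` of the skeleton `Cruxes/StressStrongMixing/Lines/birth.lean`
(crux item stmt-AtomisticToContinuum-9584, route `MourreKoopmanCharges` of `AtomisticToContinuum/HydrodynamicLimit`): the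
implication "FlowLocality → TwoTimeClustering".  If, for small reduced diameter, every time-evolved generator `b ∘ Φ_t`
admits square-integrable local approximants `g_L` (cylinder functions of the ball `B(0, L)`) with
`E[(b ∘ Φ_t - g_L)²] ≤ K e^{-κ L}`, then for every translation-invariant density-one hard-sphere Gibbs state `μ` at
`(σ, z, θ⁻¹)`, `σ < min σ₄ (1/4)`, and any two generators `a, b`, the two-time truncated two-point function
`x ↦ Cov_μ(a, (b ∘ Φ_t) ∘ τ_x)` is integrable on `ℝ³`.

Proof: at a shift `x` with `‖x‖ ≥ 8 + 4σ` take `L = ‖x‖/2` and split `b ∘ Φ_t = g_L + (b ∘ Φ_t - g_L)`.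
* The error piece is `≤ (Var a · K e^{-κ‖x‖/2})^{1/2}` by Cauchy–Schwarz and shift invariance
  (`abs_cov_comp_spatialShift_sub_le`).
* The local piece `Cov_μ(a, g_L ∘ τ_x)` is handled exactly as the static clustering `abs_cov_generators_spatialShift_le`:
  `g_L ∘ τ_x` only sees particles with position in `B(-x, L)`, hence is frozen under the superposition of thrown points
  in `B(0, ‖x‖/2)` (`comp_spatialShift_superposeIn_ball_of_isCylinder`); clamping `a` at height `q^{-d/2}`
  (`q = 16 z σ³ ≤ 1/2` by `activity_le_two_of_density_one`, depth `4 + (d + 2)σ ≤ ‖x‖/2`), the `φ`-mixing bound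
  `abs_cov_le_of_isHardSphereGibbs` and the fourth-moment clamping error give `≤ A q^{d/2} ≤ A' e^{-c‖x‖}` with `A`
  uniform in `L` since `‖g_L‖₁ ≤ 1 + ‖g_L‖₂² ≤ 1 + 2‖b‖₂² + 2K` (`abs_cov_cylinder_spatialShift_le`).
* Both majorants are integrable on `ℝ³` (`integrable_exp_neg_mul_norm`) and the landed reduction
  `integrable_cov_flow_spatialShift_of_decay` concludes.

References: H. Spohn, *Large Scale Dynamics of Interacting Particles* (1991), Part I §7.1 (7.6), (7.14); D. Ruelle,
*Statistical Mechanics* (1969), §4.4; M. Michelen, W. Perkins, arXiv:2109.01094, Thm 3 / 25.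
-/

noncomputable section

open MeasureTheory ProbabilityTheory Filter Topology
open scoped ENNReal

namespace Summit.AtomisticToContinuum.HydrodynamicLimit.Theorems.MourreKoopmanChargesStressStrongMixing

open Literature.MathematicalPhysics.KineticTheory Literature.Analysis.FluidPDE
open Literature.Analysis.FunctionSpaces (PointConfig maxwellianBeta)
open Literature.MathematicalPhysics.StatisticalMechanics.HardSphere (window)
open Summit.AtomisticToContinuum.HydrodynamicLimit.Theorems.KiferCompactification (mem_superposeIn_iff)

/-! ### Locality of shifted cylinder observables -/

/-- **A far translate of a cylinder observable of `B(0, L)` does not see the particles thrown into `B(0, R)`**: if `g`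
is a cylinder function of the ball `B(0, L)` and `R + L ≤ ‖x‖`, then `(g ∘ τ_x)(superposeIn (B(0,R)) ξ Y) = (g ∘ τ_x) Y`
for all thrown points `ξ` and boundary conditions `Y` (`g ∘ τ_x` only sees positions in `B(-x, L) ⊆ B(0, R)ᶜ`).
[folklore] -/
theorem comp_spatialShift_superposeIn_ball_of_isCylinder {g : MarkedConfig → ℝ} {L : ℝ}
    (hcyl : IsCylinder (Metric.ball (0 : V3) L) g) {x : V3} {R : ℝ} (hRL : R + L ≤ ‖x‖) {k : ℕ}
    (ξ : Fin k → V3 × V3) (Y : MarkedConfig) :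
    (g ∘ spatialShift x) (superposeIn (Metric.ball (0 : V3) R) ξ Y) = (g ∘ spatialShift x) Y := by
  refine hcyl _ _ (PointConfig.ext fun p => ?_)
  simp only [spatialShift_apply, ← PointConfig.mem_carrier, PointConfig.carrier_restrict, PointConfig.carrier_translate,
    Set.mem_inter_iff, Set.mem_image, Set.mem_prod, Set.mem_univ, and_true]
  have key : ∀ q : V3 × V3, (q + (x, (0 : V3))).1 ∈ Metric.ball (0 : V3) L → q.1 ∉ Metric.ball (0 : V3) R := by
    intro q hq hqR
    rw [Metric.mem_ball, dist_zero_right] at hq hqR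
    rw [Prod.fst_add] at hq
    have h := norm_sub_le (q.1 + x) q.1
    rw [add_sub_cancel_left] at h
    linarith
  constructor
  · rintro ⟨⟨q, hq, rfl⟩, hpu⟩
    rcases (mem_superposeIn_iff _ ξ Y q).1 hq with ⟨-, hqΛ⟩ | ⟨hqY, -⟩
    · exact absurd hqΛ (key q hpu)
    · exact ⟨⟨q, hqY, rfl⟩, hpu⟩
  · rintro ⟨⟨q, hqY, rfl⟩, hpu⟩
    exact ⟨⟨q, (mem_superposeIn_iff _ ξ Y q).2 (Or.inr ⟨hqY, key q hpu⟩), rfl⟩, hpu⟩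

/-! ### Elementary moment bookkeeping -/

/-- On a probability space, `‖g‖₁ ≤ 1 + ‖g‖₂²` (`|y| ≤ 1 + y²`). [folklore] -/
theorem integral_abs_le_one_add_integral_sq {μ : Measure MarkedConfig} [IsProbabilityMeasure μ]
    {g : MarkedConfig → ℝ} (hg2 : MemLp g 2 μ) : ∫ ω, |g ω| ∂μ ≤ 1 + ∫ ω, g ω ^ 2 ∂μ := by
  have hg1 : Integrable g μ := hg2.integrable one_le_two
  have hsq : Integrable (fun ω => g ω ^ 2) μ := hg2.integrable_sq
  calc ∫ ω, |g ω| ∂μ ≤ ∫ ω, (1 + g ω ^ 2) ∂μ :=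
        integral_mono hg1.abs ((integrable_const 1).add hsq) fun ω => by
          dsimp only
          nlinarith [sq_nonneg (|g ω| - 1), sq_abs (g ω), abs_nonneg (g ω)]
    _ = 1 + ∫ ω, g ω ^ 2 ∂μ := by
        rw [integral_add (integrable_const 1) hsq, integral_const, probReal_univ, one_smul]

/-- `‖g‖₂² ≤ 2‖B‖₂² + 2‖B - g‖₂²` for square-integrable `B, g` (`g² ≤ 2B² + 2(B - g)²`). [folklore] -/
theorem integral_sq_le_two_mul_add {μ : Measure MarkedConfig} {B g : MarkedConfig → ℝ} (hB2 : MemLp B 2 μ)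
    (hg2 : MemLp g 2 μ) :
    ∫ ω, g ω ^ 2 ∂μ ≤ 2 * ∫ ω, B ω ^ 2 ∂μ + 2 * ∫ ω, (B ω - g ω) ^ 2 ∂μ := by
  have hh2 : MemLp (fun ω => B ω - g ω) 2 μ := hB2.sub hg2
  have hsqB : Integrable (fun ω => B ω ^ 2) μ := hB2.integrable_sq
  have hsqh : Integrable (fun ω => (B ω - g ω) ^ 2) μ := hh2.integrable_sq
  calc ∫ ω, g ω ^ 2 ∂μ ≤ ∫ ω, (2 * B ω ^ 2 + 2 * (B ω - g ω) ^ 2) ∂μ :=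
        integral_mono hg2.integrable_sq ((hsqB.const_mul 2).add (hsqh.const_mul 2)) fun ω => by
          dsimp only
          nlinarith [sq_nonneg (2 * B ω - g ω)]
    _ = 2 * ∫ ω, B ω ^ 2 ∂μ + 2 * ∫ ω, (B ω - g ω) ^ 2 ∂μ := by
        rw [integral_add (hsqB.const_mul 2) (hsqh.const_mul 2), integral_const_mul, integral_const_mul]

/-! ### The two pieces of the split `b ∘ Φ_t = g + (b ∘ Φ_t - g)` -/

/-- **The error piece** (Cauchy–Schwarz, shift-invariant form): for measurable `B, g ∈ L²(μ)`, `a ∈ L²(μ)` and shifts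
preserving the probability measure `μ`,
`|Cov_μ(a, B ∘ τ_x) - Cov_μ(a, g ∘ τ_x)| ≤ (Var a · E[(B - g)²])^{1/2}`. [folklore] -/
theorem abs_cov_comp_spatialShift_sub_le {μ : Measure MarkedConfig} [IsProbabilityMeasure μ]
    (hshift : ∀ x : V3, MeasurePreserving (spatialShift x) μ μ)
    {a B g : MarkedConfig → ℝ} (hBm : Measurable B) (hgm : Measurable g) (ha2 : MemLp a 2 μ) (hB2 : MemLp B 2 μ)
    (hg2 : MemLp g 2 μ) (x : V3) :
    |cov[a, B ∘ spatialShift x; μ] - cov[a, g ∘ spatialShift x; μ]| ≤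
      Real.sqrt (Var[a; μ] * ∫ ω, (B ω - g ω) ^ 2 ∂μ) := by
  have hh2 : MemLp (fun ω => B ω - g ω) 2 μ := hB2.sub hg2
  have hBx2 : MemLp (B ∘ spatialShift x) 2 μ := hB2.comp_measurePreserving (hshift x)
  have hgx2 : MemLp (g ∘ spatialShift x) 2 μ := hg2.comp_measurePreserving (hshift x)
  have hsub : cov[a, B ∘ spatialShift x; μ] - cov[a, g ∘ spatialShift x; μ] =
      cov[a, (fun ω => B ω - g ω) ∘ spatialShift x; μ] :=
    (covariance_fun_sub_right ha2 hBx2 hgx2).symm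
  rw [hsub]
  refine (abs_cov_comp_spatialShift_le hshift (hBm.sub hgm) ha2 hh2 x).trans (Real.sqrt_le_sqrt ?_)
  have hV : Var[fun ω => B ω - g ω; μ] ≤ ∫ ω, (B ω - g ω) ^ 2 ∂μ :=
    variance_le_expectation_sq hh2.aestronglyMeasurable
  exact mul_le_mul_of_nonneg_left hV (variance_nonneg _ _)

/-- **The local piece** (`φ`-mixing of the clamp plus the clamping error, as in `abs_cov_generators_spatialShift_le`
with a cylinder observable in place of the far generator): for a hard-sphere Gibbs state `μ` at `(σ, z, θ⁻¹)` with
`16 z σ³ < 1`, translation invariant, a generator `a`, a measurable square-integrable cylinder observable `g` of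
`B(0, L)`, a shift `x` and radii with `4 + (d + 2)σ ≤ R`, `R + L ≤ ‖x‖`, and any `K > 0`,
`|Cov_μ(a, g ∘ τ_x)| ≤ 2 K Φ (16 z σ³)^d ‖g‖₁ + (E a⁴)^{1/2} (E g²)^{1/2} / K`, `Φ = 2 ν(B_4 × ℝ³) e^{ν(B_4 × ℝ³)}`.
[cite: MichelenPerkins2021, Thm 3 and Thm 25] -/
theorem abs_cov_cylinder_spatialShift_le {σ z θ : ℝ} (hσ : 0 < σ) (hz : 0 < z) (hzσ : 16 * (z * σ ^ 3) < 1)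
    (hθ : 0 < θ) {μ : Measure MarkedConfig} (hG : IsHardSphereGibbs σ z θ⁻¹ (0 : V3) μ)
    (hti : IsTranslationInvariant μ)
    {a : MarkedConfig → ℝ} (ha : a ∈ Set.range cellCharge ∪ {cellObs fun v : V3 => v 0 * v 1})
    {g : MarkedConfig → ℝ} (hgm : Measurable g) (hg2 : MemLp g 2 μ) {L : ℝ}
    (hcyl : IsCylinder (Metric.ball (0 : V3) L) g)
    {x : V3} {R : ℝ} {d : ℕ} (hR : 4 + (d + 2) * σ ≤ R) (hRL : R + L ≤ ‖x‖) {K : ℝ} (hK : 0 < K) :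
    |cov[a, g ∘ spatialShift x; μ]| ≤
      2 * K * (2 * ((Real.toNNReal z) • ((volume : Measure V3).prod ((volume : Measure V3).withDensity
            fun v => ENNReal.ofReal (maxwellianBeta θ⁻¹ (v - 0))))).real (window (Metric.ball (0 : V3) 4)) *
          Real.exp (((Real.toNNReal z) • ((volume : Measure V3).prod ((volume : Measure V3).withDensity
            fun v => ENNReal.ofReal (maxwellianBeta θ⁻¹ (v - 0))))).real (window (Metric.ball (0 : V3) 4))) *
          (2 * (8 * (z * σ ^ 3))) ^ d) * ∫ ω, |g ω| ∂μ +
        Real.sqrt (∫ ω, a ω ^ 4 ∂μ) * Real.sqrt (∫ ω, g ω ^ 2 ∂μ) / K := by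
  haveI := hG.1
  have hshift : MeasurePreserving (spatialShift x) μ μ := ⟨PointConfig.measurable_translate _, hti x⟩
  have ham : Measurable a := measurable_of_mem_generators a ha
  have ha2 : MemLp a 2 μ := memLp_generators_of_isHardSphereGibbs σ θ z hσ hθ hz μ hG a ha
  have ha4 : Integrable (fun ω => a ω ^ 4) μ := integrable_pow_four_of_mem_generators hθ hz hG ha
  have hgxm : Measurable (g ∘ spatialShift x) := hgm.comp (PointConfig.measurable_translate _)
  have hgx2 : MemLp (g ∘ spatialShift x) 2 μ := hg2.comp_measurePreserving hshift
  -- the clamp of `a`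
  set f : MarkedConfig → ℝ := fun ω => max (-K) (min (a ω) K) with hfdef
  have hfm : Measurable f := measurable_clamp ham K
  have hfK : ∀ ω, |f ω| ≤ K := fun ω => abs_le.2 ⟨le_max_left _ _, max_le (by linarith) (min_le_right _ _)⟩
  have hf2 : MemLp f 2 μ := memLp_of_bounded (a := -K) (b := K)
    (ae_of_all _ fun ω => ⟨(abs_le.1 (hfK ω)).1, (abs_le.1 (hfK ω)).2⟩) hfm.aestronglyMeasurable 2
  have hfr : ∀ ω, f (PointConfig.restrict (window (Metric.ball (0 : V3) 4)) ω) = f ω := fun ω =>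
    clamp_restrict_window_ball_of_mem_generators ha K ω
  -- locality of the shifted cylinder observable
  have hgcyl : ∀ (n : ℕ) (ξ : Fin n → V3 × V3) (Y : MarkedConfig),
      (g ∘ spatialShift x) (superposeIn (Metric.ball (0 : V3) R) ξ Y) = (g ∘ spatialShift x) Y :=
    fun n ξ Y => comp_spatialShift_superposeIn_ball_of_isCylinder hcyl hRL ξ Y
  -- the two invariant integrals
  have hI1 : ∫ ω, |(g ∘ spatialShift x) ω| ∂μ = ∫ ω, |g ω| ∂μ := by
    have h := integral_map (μ := μ) (PointConfig.measurable_translate ((x, (0 : V3)) : V3 × V3)).aemeasurable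
      (f := fun ω => |g ω|) hgm.norm.aestronglyMeasurable
    rw [hti x] at h
    simpa only [Function.comp_apply, spatialShift_apply] using h.symm
  have hI2 : ∫ ω, ((g ∘ spatialShift x) ω) ^ 2 ∂μ = ∫ ω, g ω ^ 2 ∂μ := by
    have h := integral_map (μ := μ) (PointConfig.measurable_translate ((x, (0 : V3)) : V3 × V3)).aemeasurable
      (f := fun ω => g ω ^ 2) (hgm.pow_const 2).aestronglyMeasurable
    rw [hti x] at h
    simpa only [Function.comp_apply, spatialShift_apply] using h.symm
  -- the two pieces
  have hmix := abs_cov_le_of_isHardSphereGibbs hσ hz.le hzσ (inv_pos.2 hθ) hG hR hfm hK.le hfK hfr hgxm hgx2 hgcyl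
  have hclamp := abs_cov_sub_clamp_le ham ha4 hgx2 hK
  rw [hI1] at hmix
  rw [hI2] at hclamp
  have hsplit : cov[a, g ∘ spatialShift x; μ] =
      cov[f, g ∘ spatialShift x; μ] + cov[fun ω => a ω - max (-K) (min (a ω) K), g ∘ spatialShift x; μ] := by
    rw [covariance_fun_sub_left ha2 hf2 hgx2]; ring
  rw [hsplit]
  exact (abs_add_le _ _).trans (add_le_add hmix hclamp)

/-! ### The registered stub -/

/-- **Registered stub `stub_twoTimeClusteringOfLocality`** (line `birth` of `StressStrongMixing`): flow locality of the
time-evolved generators (square-integrable local approximants on balls with exponentially small `L²` error) implies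
the two-time spatial clustering of the six generators for every translation-invariant density-one dilute hard-sphere
Gibbs state and every equilibrium flow, for `σ < min σ₄ (1/4)` — split `b ∘ Φ_t = g_{‖x‖/2} + (b ∘ Φ_t - g_{‖x‖/2})`,
Cauchy–Schwarz for the error, clamping plus exponential `φ`-mixing for the local piece, and the landed reduction
`integrable_cov_flow_spatialShift_of_decay`. [cite: MichelenPerkins2021, Thm 3 and Thm 25] -/
theorem stub_twoTimeClusteringOfLocality :
    (∃ σ₄ : ℝ, 0 < σ₄ ∧ ∀ σ : ℝ, 0 < σ → σ < σ₄ → ∀ Φ : InfiniteHardSphereFlow (Fin 3) σ,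
      Φ.IsEquilibriumFlow → ∀ θ z : ℝ, 0 < θ → 0 < z →
      ∀ μ : Measure MarkedConfig, IsHardSphereGibbs σ z θ⁻¹ (0 : V3) μ → IsTranslationInvariant μ →
        PointProcess.density μ = 1 →
        ∀ b ∈ Set.range cellCharge ∪ {cellObs fun v : V3 => v 0 * v 1}, ∀ t : ℝ,
          ∃ K κ : ℝ, 0 ≤ K ∧ 0 < κ ∧ ∀ L : ℝ, 0 < L →
            ∃ g : MarkedConfig → ℝ, Measurable g ∧ MemLp g 2 μ ∧ IsCylinder (Metric.ball (0 : V3) L) g ∧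
              ∫ ω, (b (Φ.flow t ω) - g ω) ^ 2 ∂μ ≤ K * Real.exp (-(κ * L))) →
    ∃ σ₃ : ℝ, 0 < σ₃ ∧ ∀ σ : ℝ, 0 < σ → σ < σ₃ → ∀ Φ : InfiniteHardSphereFlow (Fin 3) σ,
      Φ.IsEquilibriumFlow → ∀ θ z : ℝ, 0 < θ → 0 < z →
      ∀ μ : Measure MarkedConfig, IsHardSphereGibbs σ z θ⁻¹ (0 : V3) μ → IsTranslationInvariant μ →
        PointProcess.density μ = 1 →
        ∀ a ∈ Set.range cellCharge ∪ {cellObs fun v : V3 => v 0 * v 1},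
        ∀ b ∈ Set.range cellCharge ∪ {cellObs fun v : V3 => v 0 * v 1}, ∀ t : ℝ,
          Integrable (fun x : V3 => cov[a, (b ∘ Φ.flow t) ∘ spatialShift x; μ]) volume := by
  rintro ⟨σ₄, hσ₄, H⟩
  refine ⟨min σ₄ (1 / 4), lt_min hσ₄ (by norm_num), fun σ hσ hσ34 Φ hΦ θ z hθ hz μ hG hti hρ a ha b hb t => ?_⟩
  have hσ4 : σ < σ₄ := lt_of_lt_of_le hσ34 (min_le_left _ _)
  have hσq : σ < 1 / 4 := lt_of_lt_of_le hσ34 (min_le_right _ _)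
  obtain ⟨K, κ, hK0, hκ, Hg⟩ := H σ hσ hσ4 Φ hΦ θ z hθ hz μ hG hti hρ b hb t
  haveI := hG.1
  have hS : Φ.IsStationary μ := (hΦ z θ⁻¹ hz (inv_pos.2 hθ) μ hG).2
  have hshift : ∀ y : V3, MeasurePreserving (spatialShift y) μ μ := fun y =>
    ⟨PointConfig.measurable_translate _, hti y⟩
  have ham : Measurable a := measurable_of_mem_generators a ha
  have hbm : Measurable b := measurable_of_mem_generators b hb
  have ha2 : MemLp a 2 μ := memLp_generators_of_isHardSphereGibbs σ θ z hσ hθ hz μ hG a ha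
  have hb2 : MemLp b 2 μ := memLp_generators_of_isHardSphereGibbs σ θ z hσ hθ hz μ hG b hb
  set B : MarkedConfig → ℝ := b ∘ Φ.flow t with hBdef
  have hBm : Measurable B := hbm.comp (Φ.measurable_flow t)
  have hB2 : MemLp B 2 μ := hb2.comp_measurePreserving (hS.measurePreserving t)
  -- smallness: `σ³ ≤ 1/64`, `z ≤ 2`, `q = 16 z σ³ ∈ (0, 1/2]`
  have hσ3 : σ ^ 3 ≤ 1 / 64 := by
    have h : σ ^ 3 ≤ (1 / 4) ^ 3 := pow_le_pow_left₀ hσ.le hσq.le 3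
    norm_num at h
    exact h
  have hz2 : z ≤ 2 := activity_le_two_of_density_one hσ (by linarith) hz.le (inv_pos.2 hθ) hG hti hρ
  set q : ℝ := 2 * (8 * (z * σ ^ 3)) with hqdef
  have hq0 : 0 < q := by positivity
  have hq1 : q ≤ 1 / 2 := by
    have : z * σ ^ 3 ≤ 2 * (1 / 64) := mul_le_mul hz2 hσ3 (by positivity) zero_le_two
    rw [hqdef]; linarith
  have hzσ : 16 * (z * σ ^ 3) < 1 := by rw [hqdef] at hq1; linarith
  set s : ℝ := Real.sqrt q with hsdef
  have hs0 : 0 < s := Real.sqrt_pos.2 hq0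
  have hs1 : s < 1 := by
    rw [hsdef, Real.sqrt_lt' one_pos]; linarith
  have hsq : s ^ 2 = q := Real.sq_sqrt hq0.le
  have hlog : Real.log s < 0 := Real.log_neg hs0 hs1
  -- the constants of the majorant (uniform in the locality radius `L`)
  set Φ₀ : ℝ := 2 * ((Real.toNNReal z) • ((volume : Measure V3).prod ((volume : Measure V3).withDensity
      fun v => ENNReal.ofReal (maxwellianBeta θ⁻¹ (v - 0))))).real (window (Metric.ball (0 : V3) 4)) *
    Real.exp (((Real.toNNReal z) • ((volume : Measure V3).prod ((volume : Measure V3).withDensity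
      fun v => ENNReal.ofReal (maxwellianBeta θ⁻¹ (v - 0))))).real (window (Metric.ball (0 : V3) 4))) with hΦdef
  have hΦ0 : 0 ≤ Φ₀ := by rw [hΦdef]; exact mul_nonneg (mul_nonneg zero_le_two measureReal_nonneg) (Real.exp_nonneg _)
  set M₂ : ℝ := 2 * ∫ ω, B ω ^ 2 ∂μ + 2 * K with hM₂def
  have hM₂0 : 0 ≤ M₂ := by
    rw [hM₂def]
    exact add_nonneg (mul_nonneg zero_le_two (integral_nonneg fun ω => sq_nonneg _)) (mul_nonneg zero_le_two hK0)
  set A : ℝ := 2 * Φ₀ * (1 + M₂) + Real.sqrt (∫ ω, a ω ^ 4 ∂μ) * Real.sqrt M₂ with hAdef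
  have hA0 : 0 ≤ A := by
    rw [hAdef]
    exact add_nonneg (mul_nonneg (mul_nonneg zero_le_two hΦ0) (by linarith))
      (mul_nonneg (Real.sqrt_nonneg _) (Real.sqrt_nonneg _))
  -- the majorant: `A exp(log s ((‖y‖ - 8)/(2σ) - 3)) + (Var a · K)^{1/2} e^{-(κ/4)‖y‖}`
  set c : ℝ := -Real.log s / (2 * σ) with hcdef
  have hc : 0 < c := div_pos (by linarith) (by positivity)
  have hgeq : ∀ y : V3, A * Real.exp (Real.log s * ((‖y‖ - 8) / (2 * σ) - 3)) =
      A * Real.exp (-(Real.log s) * (8 / (2 * σ) + 3)) * Real.exp (-(c * ‖y‖)) := fun y => by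
    rw [mul_assoc, ← Real.exp_add]
    congr 2
    rw [hcdef]
    field_simp
    ring
  have hgint : Integrable (fun y : V3 => A * Real.exp (Real.log s * ((‖y‖ - 8) / (2 * σ) - 3)) +
      Real.sqrt (Var[a; μ] * K) * Real.exp (-(κ / 4 * ‖y‖))) volume := by
    refine Integrable.add ?_ ((integrable_exp_neg_mul_norm (by positivity : 0 < κ / 4)).const_mul _)
    simp_rw [hgeq]
    exact (integrable_exp_neg_mul_norm hc).const_mul _
  -- the endgame
  refine integrable_cov_flow_spatialShift_of_decay Φ hS hshift ham hbm ha2 hb2 t hgint (R := 8 + 4 * σ)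
    fun x hx => ?_
  -- the decay estimate at a shift `x` with `‖x‖ ≥ 8 + 4σ`: local approximant on `B(0, ‖x‖/2)`
  have hL : 0 < ‖x‖ / 2 := by linarith
  obtain ⟨g, hgm, hg2, hcyl, hgerr⟩ := Hg (‖x‖ / 2) hL
  -- depth bookkeeping at scale `2σ`
  obtain ⟨hd1, hd2⟩ := depth_spec (σ := 2 * σ) (by positivity) (x := x) (by linarith)
  set d : ℕ := ⌊(‖x‖ - 8) / (2 * σ)⌋₊ - 2 with hddef
  have hR : 4 + (d + 2) * σ ≤ ‖x‖ / 2 := by linarith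
  have hRL : ‖x‖ / 2 + ‖x‖ / 2 ≤ ‖x‖ := by linarith
  have hsd : 0 < s ^ d := pow_pos hs0 d
  -- moments of the approximant, uniformly in `L`
  have herr1 : ∫ ω, (B ω - g ω) ^ 2 ∂μ ≤ K * Real.exp (-(κ * (‖x‖ / 2))) := by
    simpa only [hBdef, Function.comp_apply] using hgerr
  have herrK : ∫ ω, (B ω - g ω) ^ 2 ∂μ ≤ K := by
    refine herr1.trans ?_
    have he : Real.exp (-(κ * (‖x‖ / 2))) ≤ 1 := Real.exp_le_one_iff.2 (by nlinarith [norm_nonneg x])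
    nlinarith
  have hIg2 : ∫ ω, g ω ^ 2 ∂μ ≤ M₂ := by
    rw [hM₂def]
    exact (integral_sq_le_two_mul_add hB2 hg2).trans (by linarith)
  have hIg1 : ∫ ω, |g ω| ∂μ ≤ 1 + M₂ := (integral_abs_le_one_add_integral_sq hg2).trans (by linarith)
  -- the two pieces
  have key1 := abs_cov_cylinder_spatialShift_le hσ hz hzσ hθ hG hti ha hgm hg2 hcyl hR hRL (inv_pos.2 hsd)
  have key2 := abs_cov_comp_spatialShift_sub_le hshift hBm hgm ha2 hB2 hg2 x
  have hqd : q ^ d = s ^ d * s ^ d := by rw [← hsq, ← mul_pow, sq]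
  have hE : Real.exp (-(κ * (‖x‖ / 2))) = Real.exp (-(κ / 4 * ‖x‖)) ^ 2 := by
    rw [sq, ← Real.exp_add]
    congr 1
    ring
  have hpiece2 : Real.sqrt (Var[a; μ] * ∫ ω, (B ω - g ω) ^ 2 ∂μ) ≤
      Real.sqrt (Var[a; μ] * K) * Real.exp (-(κ / 4 * ‖x‖)) := by
    calc Real.sqrt (Var[a; μ] * ∫ ω, (B ω - g ω) ^ 2 ∂μ)
        ≤ Real.sqrt (Var[a; μ] * (K * Real.exp (-(κ * (‖x‖ / 2))))) :=
          Real.sqrt_le_sqrt (mul_le_mul_of_nonneg_left herr1 (variance_nonneg _ _))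
      _ = Real.sqrt (Var[a; μ] * K) * Real.exp (-(κ / 4 * ‖x‖)) := by
          rw [hE, ← mul_assoc, Real.sqrt_mul (mul_nonneg (variance_nonneg _ _) hK0),
            Real.sqrt_sq (Real.exp_pos _).le]
  have hpiece1 : 2 * (s ^ d)⁻¹ * (Φ₀ * q ^ d) * ∫ ω, |g ω| ∂μ +
      Real.sqrt (∫ ω, a ω ^ 4 ∂μ) * Real.sqrt (∫ ω, g ω ^ 2 ∂μ) / (s ^ d)⁻¹ ≤
      2 * (s ^ d)⁻¹ * (Φ₀ * q ^ d) * (1 + M₂) + Real.sqrt (∫ ω, a ω ^ 4 ∂μ) * Real.sqrt M₂ / (s ^ d)⁻¹ := by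
    have h1 : 0 ≤ 2 * (s ^ d)⁻¹ * (Φ₀ * q ^ d) :=
      mul_nonneg (mul_nonneg zero_le_two (inv_pos.2 hsd).le) (mul_nonneg hΦ0 (pow_pos hq0 d).le)
    refine add_le_add (mul_le_mul_of_nonneg_left hIg1 h1) ?_
    rw [div_le_div_iff_of_pos_right (inv_pos.2 hsd)]
    exact mul_le_mul_of_nonneg_left (Real.sqrt_le_sqrt hIg2) (Real.sqrt_nonneg _)
  calc |cov[a, B ∘ spatialShift x; μ]|
      ≤ |cov[a, g ∘ spatialShift x; μ]| + |cov[a, B ∘ spatialShift x; μ] - cov[a, g ∘ spatialShift x; μ]| := by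
        have h := abs_add_le (cov[a, g ∘ spatialShift x; μ])
          (cov[a, B ∘ spatialShift x; μ] - cov[a, g ∘ spatialShift x; μ])
        rwa [add_sub_cancel] at h
    _ ≤ (2 * (s ^ d)⁻¹ * (Φ₀ * q ^ d) * ∫ ω, |g ω| ∂μ +
          Real.sqrt (∫ ω, a ω ^ 4 ∂μ) * Real.sqrt (∫ ω, g ω ^ 2 ∂μ) / (s ^ d)⁻¹) +
        Real.sqrt (Var[a; μ] * ∫ ω, (B ω - g ω) ^ 2 ∂μ) := by
        refine add_le_add ?_ key2
        simpa only [hΦdef, hqdef, mul_assoc] using key1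
    _ ≤ (2 * (s ^ d)⁻¹ * (Φ₀ * q ^ d) * (1 + M₂) + Real.sqrt (∫ ω, a ω ^ 4 ∂μ) * Real.sqrt M₂ / (s ^ d)⁻¹) +
        Real.sqrt (Var[a; μ] * K) * Real.exp (-(κ / 4 * ‖x‖)) := add_le_add hpiece1 hpiece2
    _ = A * s ^ d + Real.sqrt (Var[a; μ] * K) * Real.exp (-(κ / 4 * ‖x‖)) := by
        congr 1
        rw [hqd, hAdef, div_inv_eq_mul]
        field_simp
    _ ≤ A * Real.exp (Real.log s * ((‖x‖ - 8) / (2 * σ) - 3)) +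
        Real.sqrt (Var[a; μ] * K) * Real.exp (-(κ / 4 * ‖x‖)) :=
        add_le_add (mul_le_mul_of_nonneg_left (pow_le_exp_log_mul hs0 hs1.le hd2) hA0) le_rfl

end Summit.AtomisticToContinuum.HydrodynamicLimit.Theorems.MourreKoopmanChargesStressStrongMixing

end
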